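import Summits.BirchSwinnertonDyer.BirchSwinnertonDyer.Theorems.ResidualThetaTransportAtTwoThetaLayerLambdaCongruenceAtTwoDualChainCrossing
import HarnessLib

/-!
# Crux `ThetaLayerLambdaCongruenceAtTwo` (stmt-BirchSwinnertonDyer-20688, route ResidualThetaTransportAtTwo), line
# `birth` v14 — SD floor, kernel road, Hecke clause of IP, brick HA1 «ANCHORS»: the sum of the crossing vectors of the dual chains of a
# Hecke cocycle `δ_i` equals the sum of the crossing vectors of ANY dual walks from anchors `m_i` to `δ_i m_{σ i}` (width seat
# bsd-wall-rtt-p3-w3 g11; `--supports stmt-BirchSwinnertonDyer-20688 --as helper`; closes nothing)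

HONEST FRAMING. Elementary THEOREMS on lists of matrices and the coset space `SL₂(ℤ)/Γ₀(N)`, in the currency of `…DualChain` /
`…DualChainCrossing` (w2 g8); no definition; nothing about any curve or form is asserted; BSD is not proved by any of this.

WHY (memo `Cruxes/ThetaLayerLambdaCongruenceAtTwo/Lines/birth-sd2-hecke-adjoint.md`, step (A)). A Hecke operator acts on the period lattice by
`T per γ = Σ_i per δ_i` where `α_i γ = δ_i α_{σ i}` is the permutation cocycle of a right-coset decomposition `Γ₀αΓ₀ = ⊔ Γ₀ α_i` (tree:
`exists_dualMap_heckeT_periodFunctional`; the `δ_i` are in `Γ₀(N)`, `σ` is a permutation). On the dual (crossing-vector) side one wants to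
replace the honest dual chains of the `δ_i` (walks from the base triangle to `δ_i`·base) by the «translated walks» from an anchor triangle
`m_i` (later: the Farey triangle containing the flag `α_i·φ₀`) to `δ_i m_{σ i}` (the triangle containing `α_i γ φ₀`). THEOREM
`sum_dualChainVec_anchor`: for ANY anchors `m_i ∈ SL₂(ℤ)` and ANY such walks the two sums of crossing vectors agree — the connecting walks
base → `m_i` cancel against the `Γ₀(N)`-translates `δ_i`·(base → `m_{σ i}`) because `σ` is a permutation and crossing vectors are
`Γ₀(N)`-invariant. Also: chain independence for dual walks between two arbitrary triangles (`dualChainVec_eq_of_dualChain_between`) and the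
explicit three-piece walk (`dualChain_between_of_pieces`).

References: [Manin1972] §1.5–1.7; [Merel1995Homologie] §2.1–2.2 (the cocycle `λ(xr) r⁻¹ M`); [Shimura1971] §3.1 (coset permutations).
-/

set_option autoImplicit false

noncomputable section

-- justification: the `Summit.BirchSwinnertonDyer.BirchSwinnertonDyer.…` path repeats a component (route-file convention)
set_option linter.dupNamespace false

open scoped Classical MatrixGroups

open CongruenceSubgroup Matrix.SpecialLinearGroup ModularGroup
open Literature.NumberTheory.EllipticCurves.ModularForms

namespace Summit.BirchSwinnertonDyer.BirchSwinnertonDyer.Theorems.ThetaLayerLambdaCongruenceAtTwo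

section Anchors

variable {N : ℕ}

/-- **Chain independence between two triangles.** Two dual walks `E, E'` from the triangle of `k₁` to the triangle of `k₂`
(`Σ_{h} (G h − G(hS)) = G k₂ − G k₁` for all triangle functions `G`) have the same signed crossing vector on `SL₂(ℤ)/Γ₀(N)`:
`E ++ E'·S` is a closed dual chain (`dualChainVec_eq_zero_of_closed`). [cite: Manin1972, §1.5] -/
theorem dualChainVec_eq_of_dualChain_between (k₁ k₂ : SL(2, ℤ)) (E E' : List SL(2, ℤ))
    (hE : ∀ {A : Type} [AddCommGroup A] (G : SL(2, ℤ) → A),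
      (∀ x, G (x * (S * T⁻¹)) = G x) → (∀ x, G (-x) = G x) → (E.map fun h ↦ G h - G (h * S)).sum = G k₂ - G k₁)
    (hE' : ∀ {A : Type} [AddCommGroup A] (G : SL(2, ℤ) → A),
      (∀ x, G (x * (S * T⁻¹)) = G x) → (∀ x, G (-x) = G x) → (E'.map fun h ↦ G h - G (h * S)).sum = G k₂ - G k₁)
    (q : Gamma0Coset N) :
    (E.map fun h ↦ (Pi.single ((h⁻¹ : SL(2, ℤ)) : Gamma0Coset N) (1 : ℤ) -
      Pi.single (((h * S)⁻¹ : SL(2, ℤ)) : Gamma0Coset N) 1 : Gamma0Coset N → ℤ)).sum q =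
    (E'.map fun h ↦ (Pi.single ((h⁻¹ : SL(2, ℤ)) : Gamma0Coset N) (1 : ℤ) -
      Pi.single (((h * S)⁻¹ : SL(2, ℤ)) : Gamma0Coset N) 1 : Gamma0Coset N → ℤ)).sum q := by
  have hcl : ∀ {A : Type} [AddCommGroup A] (G : SL(2, ℤ) → A), (∀ x, G (x * (S * T⁻¹)) = G x) → (∀ x, G (-x) = G x) →
      ((E ++ E'.map fun h ↦ h * S).map fun h ↦ G h - G (h * S)).sum = 0 := by
    intro A _ G hτ hn
    rw [List.map_append, List.sum_append, hE G hτ hn, List.map_map]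
    have e : (E'.map ((fun h ↦ G h - G (h * S)) ∘ fun h ↦ h * S)).sum = -(E'.map fun h ↦ G h - G (h * S)).sum := by
      rw [List.sum_neg, List.map_map]
      congr 1
      refine List.map_congr_left fun h _ ↦ ?_
      simp only [Function.comp_apply, mul_assoc, S_mul_S_eq_neg_one, mul_neg_one, hn, neg_sub]
    rw [e, hE' G hτ hn]
    abel
  have h0 := dualChainVec_eq_zero_of_closed (N := N) _ hcl q
  rw [List.map_append, List.sum_append, Pi.add_apply, dualChainVec_map_mul_S] at h0
  omega

/-- **The three-piece walk.** If `A₁` is a dual chain of `m₁`, `D` a dual chain of `δ` and `A₂` a dual chain of `m₂`, then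
`A₁·S ++ D ++ δ·A₂` is a dual walk from the triangle of `m₁` to the triangle of `δ m₂` (reverse the first walk, go to `δ`, then translate
the third walk by `δ`). [cite: Manin1972, §1.5] -/
theorem dualChain_between_of_pieces (m₁ m₂ δ : SL(2, ℤ)) (A₁ A₂ D : List SL(2, ℤ))
    (hA₁ : ∀ {A : Type} [AddCommGroup A] (G : SL(2, ℤ) → A),
      (∀ x, G (x * (S * T⁻¹)) = G x) → (∀ x, G (-x) = G x) → (A₁.map fun h ↦ G h - G (h * S)).sum = G m₁ - G 1)
    (hA₂ : ∀ {A : Type} [AddCommGroup A] (G : SL(2, ℤ) → A),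
      (∀ x, G (x * (S * T⁻¹)) = G x) → (∀ x, G (-x) = G x) → (A₂.map fun h ↦ G h - G (h * S)).sum = G m₂ - G 1)
    (hD : ∀ {A : Type} [AddCommGroup A] (G : SL(2, ℤ) → A),
      (∀ x, G (x * (S * T⁻¹)) = G x) → (∀ x, G (-x) = G x) → (D.map fun h ↦ G h - G (h * S)).sum = G δ - G 1)
    {A : Type} [AddCommGroup A] (G : SL(2, ℤ) → A) (hτ : ∀ x, G (x * (S * T⁻¹)) = G x) (hn : ∀ x, G (-x) = G x) :
    (((A₁.map fun h ↦ h * S) ++ D ++ A₂.map fun h ↦ δ * h).map fun h ↦ G h - G (h * S)).sum = G (δ * m₂) - G m₁ := by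
  rw [List.map_append, List.map_append, List.sum_append, List.sum_append, hD G hτ hn, List.map_map, List.map_map]
  have e₁ : (A₁.map ((fun h ↦ G h - G (h * S)) ∘ fun h ↦ h * S)).sum = -(A₁.map fun h ↦ G h - G (h * S)).sum := by
    rw [List.sum_neg, List.map_map]
    congr 1
    refine List.map_congr_left fun h _ ↦ ?_
    simp only [Function.comp_apply, mul_assoc, S_mul_S_eq_neg_one, mul_neg_one, hn, neg_sub]
  have e₂ : (A₂.map ((fun h ↦ G h - G (h * S)) ∘ fun h ↦ δ * h)).sum = G (δ * m₂) - G δ := by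
    have h2 := hA₂ (fun g ↦ G (δ * g)) (fun g ↦ by rw [← mul_assoc, hτ]) (fun g ↦ by simp only [mul_neg, hn])
    simp only [mul_one] at h2
    rw [← h2]
    congr 1
    exact List.map_congr_left fun g _ ↦ by simp [mul_assoc]
  rw [e₁, e₂, hA₁ G hτ hn]
  abel

/-- **Anchors (memo step (A)).** Let `δ_i ∈ Γ₀(N)` (`i` in a finite index type), `σ` a permutation of the indices, `m_i ∈ SL₂(ℤ)` arbitrary
«anchors», `D_i` dual chains of the `δ_i` and `E_i` dual walks from the triangle of `m_i` to the triangle of `δ_i m_{σ i}`. Then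
`Σ_i vec(E_i) = Σ_i vec(D_i)` on `SL₂(ℤ)/Γ₀(N)`: by chain independence `vec(E_i) = −vec(A_i) + vec(D_i) + vec(δ_i·A_{σ i})`
(`A_i` a dual chain of `m_i`), `vec(δ_i·A_{σ i}) = vec(A_{σ i})` (`Γ₀(N)`-invariance), and `Σ_i vec(A_{σ i}) = Σ_i vec(A_i)`. This is the
bookkeeping that lets the Hecke cocycle `α_i γ = δ_i α_{σ i}` act on crossing vectors through translated walks.
[cite: Merel1995Homologie, §2.1–2.2] [cite: Manin1972, §1.5] -/
theorem sum_dualChainVec_anchor {ι : Type} [Fintype ι] (σ : Equiv.Perm ι) (δ : ι → Gamma0 N) (m : ι → SL(2, ℤ))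
    (D E : ι → List SL(2, ℤ))
    (hD : ∀ i, ∀ {A : Type} [AddCommGroup A] (G : SL(2, ℤ) → A),
      (∀ x, G (x * (S * T⁻¹)) = G x) → (∀ x, G (-x) = G x) →
        ((D i).map fun h ↦ G h - G (h * S)).sum = G ((δ i : Gamma0 N) : SL(2, ℤ)) - G 1)
    (hE : ∀ i, ∀ {A : Type} [AddCommGroup A] (G : SL(2, ℤ) → A),
      (∀ x, G (x * (S * T⁻¹)) = G x) → (∀ x, G (-x) = G x) →
        ((E i).map fun h ↦ G h - G (h * S)).sum = G (((δ i : Gamma0 N) : SL(2, ℤ)) * m (σ i)) - G (m i))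
    (q : Gamma0Coset N) :
    ∑ i, ((E i).map fun h ↦ (Pi.single ((h⁻¹ : SL(2, ℤ)) : Gamma0Coset N) (1 : ℤ) -
      Pi.single (((h * S)⁻¹ : SL(2, ℤ)) : Gamma0Coset N) 1 : Gamma0Coset N → ℤ)).sum q =
    ∑ i, ((D i).map fun h ↦ (Pi.single ((h⁻¹ : SL(2, ℤ)) : Gamma0Coset N) (1 : ℤ) -
      Pi.single (((h * S)⁻¹ : SL(2, ℤ)) : Gamma0Coset N) 1 : Gamma0Coset N → ℤ)).sum q := by
  -- dual chains of the anchors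
  choose A hA using fun i ↦ exists_dualChain (m i)
  -- the crossing numbers at `q` of the anchor chains and of the cocycle chains
  set a : ι → ℤ := fun i ↦ ((A i).map fun h ↦ (Pi.single ((h⁻¹ : SL(2, ℤ)) : Gamma0Coset N) (1 : ℤ) -
      Pi.single (((h * S)⁻¹ : SL(2, ℤ)) : Gamma0Coset N) 1 : Gamma0Coset N → ℤ)).sum q with ha
  set d : ι → ℤ := fun i ↦ ((D i).map fun h ↦ (Pi.single ((h⁻¹ : SL(2, ℤ)) : Gamma0Coset N) (1 : ℤ) -
      Pi.single (((h * S)⁻¹ : SL(2, ℤ)) : Gamma0Coset N) 1 : Gamma0Coset N → ℤ)).sum q with hd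
  -- each translated walk has crossing number `−a i + d i + a (σ i)`
  have key : ∀ i, ((E i).map fun h ↦ (Pi.single ((h⁻¹ : SL(2, ℤ)) : Gamma0Coset N) (1 : ℤ) -
      Pi.single (((h * S)⁻¹ : SL(2, ℤ)) : Gamma0Coset N) 1 : Gamma0Coset N → ℤ)).sum q = -a i + d i + a (σ i) := by
    intro i
    have hE' : ∀ {B : Type} [AddCommGroup B] (G : SL(2, ℤ) → B), (∀ x, G (x * (S * T⁻¹)) = G x) → (∀ x, G (-x) = G x) →
        ((((A i).map fun h ↦ h * S) ++ D i ++ (A (σ i)).map fun h ↦ ((δ i : Gamma0 N) : SL(2, ℤ)) * h).map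
          fun h ↦ G h - G (h * S)).sum = G (((δ i : Gamma0 N) : SL(2, ℤ)) * m (σ i)) - G (m i) :=
      fun G hτ hn ↦ dualChain_between_of_pieces (m i) (m (σ i)) ((δ i : Gamma0 N) : SL(2, ℤ)) (A i) (A (σ i)) (D i)
        (hA i) (hA (σ i)) (hD i) G hτ hn
    rw [dualChainVec_eq_of_dualChain_between (m i) (((δ i : Gamma0 N) : SL(2, ℤ)) * m (σ i)) (E i)
      ((((A i).map fun h ↦ h * S) ++ D i ++ (A (σ i)).map fun h ↦ ((δ i : Gamma0 N) : SL(2, ℤ)) * h)) (hE i) hE' q]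
    rw [List.map_append, List.map_append, List.sum_append, List.sum_append, Pi.add_apply, Pi.add_apply,
      dualChainVec_map_mul_S, dualChainVec_map_mul_left]
  simp only [key]
  rw [Finset.sum_add_distrib, Finset.sum_add_distrib, Equiv.sum_comp σ a, Finset.sum_neg_distrib]
  abel

end Anchors

end Summit.BirchSwinnertonDyer.BirchSwinnertonDyer.Theorems.ThetaLayerLambdaCongruenceAtTwo

end
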